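import Mathlib
import HarnessLib
import Summits.Ventures.HSemireg.UniformMarginMomentIdentity
import Summits.Ventures.HSemireg.UniformMarginPhiLaw
import Summits.Ventures.HSemireg.UniformMarginWindow

/-!
# Venture HSemireg — COROLLARY M⁺ UNCONDITIONAL: the window off the flat locus for 0 ∕ 1 level-uniform designs (W5 seat w5-n6-2 gen 19; COMPOSITION FILE)

Bookkeeping of the computation cell `pub-hsemireg`, group W5 (`widen/W5/KERNEL-M-w5n62g19.md` §10 ∕ §12). This file only
COMPOSES three tree files: `UniformMarginMomentIdentity` (THEOREM M⁺), `UniformMarginPhiLaw` (the `|S| = 4` dictionary ⇒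
Φ⁺-law) and `UniformMarginWindow` (COROLLARY M⁺ with those two as hypotheses). CONDITIONAL ROW: it can be checked and filed
only after all three are ACCEPTED and BUILT.

* `marginWindow_of_design` — for six `0 ∕ 1` matrices over an ordered field with level-uniform margins (`Σ μ = m` on `A, B,
  C`, level counts `tA … tD`), the four TRIANGLE LAWS (N7F §3.6 (b)) and the `|S| = 4` identity (N7F §3.8 (a), as printed)
  give `0 ≤ 36 ΣB + 33 ΣC − 15 ΣPaw − 2 Σ_X (Σ_{W≠X} t_W)·p_X − 3 m s·(tA + tB + tC + tD) − 24 m² − 36 m s²`.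

HONEST FRAMING: a composition of finite-sum identities; the class equations are hypotheses quoted as printed. Nothing in this
file says that HC, HC_CM or HC_AV holds; no door ∕ tier ∕ report sentence of the cell is a consequence of this file alone.
-/

namespace Summit.Ventures.HSemireg
namespace UniformMarginWindowDesign
open Finset

variable {F : Type*} [Field F] [LinearOrder F] [IsStrictOrderedRing F]
variable {A B C D : Type*} [Fintype A] [Fintype B] [Fintype C] [Fintype D]

/-- **COROLLARY M⁺, unconditional in THEOREM M⁺ and the Φ⁺-law**: `0 ∕ 1` matrices with level-uniform margins, the four
triangle laws and the printed `|S| = 4` identity give the window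
`0 ≤ 36 ΣB + 33 ΣC − 15 ΣPaw − 2 Σ_X (Σ_{W≠X} t_W)·p_X − 3 m s (tA + tB + tC + tD) − 24 m² − 36 m s²`. -/
theorem marginWindow_of_design (tA tB tC tD m s : F)
    (μA : A → F) (μB : B → F) (μC : C → F) (μD : D → F)
    (xAB : A → B → F) (xAC : A → C → F) (xAD : A → D → F)
    (xBC : B → C → F) (xBD : B → D → F) (xCD : C → D → F)
    (zAB : ∀ a b, xAB a b = 0 ∨ xAB a b = 1) (zAC : ∀ a c, xAC a c = 0 ∨ xAC a c = 1)
    (zAD : ∀ a e, xAD a e = 0 ∨ xAD a e = 1) (zBC : ∀ b c, xBC b c = 0 ∨ xBC b c = 1)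
    (zBD : ∀ b e, xBD b e = 0 ∨ xBD b e = 1) (zCD : ∀ c e, xCD c e = 0 ∨ xCD c e = 1)
    (hA : (Fintype.card A : F) = tA) (hB : (Fintype.card B : F) = tB)
    (hC : (Fintype.card C : F) = tC) (hD : (Fintype.card D : F) = tD)
    (hmA : ∑ a, μA a = m) (hmB : ∑ b, μB b = m) (hmC : ∑ c, μC c = m)
    (rAB : ∀ a, ∑ b, xAB a b = μA a) (cAB : ∀ b, ∑ a, xAB a b = μB b)
    (rAC : ∀ a, ∑ c, xAC a c = μA a) (cAC : ∀ c, ∑ a, xAC a c = μC c)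
    (rAD : ∀ a, ∑ e, xAD a e = μA a) (cAD : ∀ e, ∑ a, xAD a e = μD e)
    (rBC : ∀ b, ∑ c, xBC b c = μB b) (cBC : ∀ c, ∑ b, xBC b c = μC c)
    (rBD : ∀ b, ∑ e, xBD b e = μB b) (cBD : ∀ e, ∑ b, xBD b e = μD e)
    (rCD : ∀ c, ∑ e, xCD c e = μC c) (cCD : ∀ e, ∑ c, xCD c e = μD e)
    (hTABC : (∑ a, ∑ b, ∑ c, xAB a b * xAC a c * xBC b c)
      = (∑ a, μA a * μA a) + (∑ b, μB b * μB b) + (∑ c, μC c * μC c) + m * s)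
    (hTABD : (∑ a, ∑ b, ∑ e, xAB a b * xAD a e * xBD b e)
      = (∑ a, μA a * μA a) + (∑ b, μB b * μB b) + (∑ e, μD e * μD e) + m * s)
    (hTACD : (∑ a, ∑ c, ∑ e, xAC a c * xAD a e * xCD c e)
      = (∑ a, μA a * μA a) + (∑ c, μC c * μC c) + (∑ e, μD e * μD e) + m * s)
    (hTBCD : (∑ b, ∑ c, ∑ e, xBC b c * xBD b e * xCD c e)
      = (∑ b, μB b * μB b) + (∑ c, μC c * μC c) + (∑ e, μD e * μD e) + m * s)
    (h4 : m * (s ^ 2 - m)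
      = - 3 * m ^ 2
        + 2 * ((∑ a, ∑ b, μA a * xAB a b * μB b) + (∑ a, ∑ c, μA a * xAC a c * μC c)
          + (∑ a, ∑ e, μA a * xAD a e * μD e) + (∑ b, ∑ c, μB b * xBC b c * μC c)
          + (∑ b, ∑ e, μB b * xBD b e * μD e) + (∑ c, ∑ e, μC c * xCD c e * μD e))
        + ((∑ a, μA a * μA a * μA a) + (∑ b, μB b * μB b * μB b)
          + (∑ c, μC c * μC c * μC c) + (∑ e, μD e * μD e * μD e))
        - ((∑ a, ∑ b, ∑ c, ∑ e, xAB a b * xAD a e * xBC b c * xCD c e)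
          + (∑ a, ∑ b, ∑ c, ∑ e, xAB a b * xAC a c * xBD b e * xCD c e)
          + (∑ a, ∑ b, ∑ c, ∑ e, xAC a c * xAD a e * xBC b c * xBD b e))
        - ((∑ a, (∑ b, ∑ c, xAB a b * xAC a c * xBC b c) * μA a)
          + (∑ a, ∑ b, (∑ c, xAB a b * xAC a c * xBC b c) * μB b)
          + (∑ a, ∑ b, ∑ c, xAB a b * xAC a c * xBC b c * μC c)
          + (∑ a, (∑ b, ∑ e, xAB a b * xAD a e * xBD b e) * μA a)
          + (∑ a, ∑ b, (∑ e, xAB a b * xAD a e * xBD b e) * μB b)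
          + (∑ a, ∑ b, ∑ e, xAB a b * xAD a e * xBD b e * μD e)
          + (∑ a, (∑ c, ∑ e, xAC a c * xAD a e * xCD c e) * μA a)
          + (∑ a, ∑ c, (∑ e, xAC a c * xAD a e * xCD c e) * μC c)
          + (∑ a, ∑ c, ∑ e, xAC a c * xAD a e * xCD c e * μD e)
          + (∑ b, (∑ c, ∑ e, xBC b c * xBD b e * xCD c e) * μB b)
          + (∑ b, ∑ c, (∑ e, xBC b c * xBD b e * xCD c e) * μC c)
          + (∑ b, ∑ c, ∑ e, xBC b c * xBD b e * xCD c e * μD e))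
        + ((∑ a, ∑ b, ∑ c, ∑ e, xAC a c * xAD a e * xBC b c * xBD b e * xCD c e)
          + (∑ a, ∑ b, ∑ c, ∑ e, xAB a b * xAD a e * xBC b c * xBD b e * xCD c e)
          + (∑ a, ∑ b, ∑ c, ∑ e, xAB a b * xAC a c * xBC b c * xBD b e * xCD c e)
          + (∑ a, ∑ b, ∑ c, ∑ e, xAB a b * xAC a c * xAD a e * xBD b e * xCD c e)
          + (∑ a, ∑ b, ∑ c, ∑ e, xAB a b * xAC a c * xAD a e * xBC b c * xCD c e)
          + (∑ a, ∑ b, ∑ c, ∑ e, xAB a b * xAC a c * xAD a e * xBC b c * xBD b e))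
        - (∑ a, ∑ b, ∑ c, ∑ e, xAB a b * xAC a c * xAD a e * xBC b c * xBD b e * xCD c e))
 :
    0 ≤ 36 * ((∑ a, ∑ b, μA a * xAB a b * μB b) + (∑ a, ∑ c, μA a * xAC a c * μC c)
          + (∑ a, ∑ e, μA a * xAD a e * μD e) + (∑ b, ∑ c, μB b * xBC b c * μC c)
          + (∑ b, ∑ e, μB b * xBD b e * μD e) + (∑ c, ∑ e, μC c * xCD c e * μD e))
        + 33 * ((∑ a, μA a * μA a * μA a) + (∑ b, μB b * μB b * μB b)
          + (∑ c, μC c * μC c * μC c) + (∑ e, μD e * μD e * μD e))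
        - 15 * ((∑ a, (∑ b, ∑ c, xAB a b * xAC a c * xBC b c) * μA a)
          + (∑ a, ∑ b, (∑ c, xAB a b * xAC a c * xBC b c) * μB b)
          + (∑ a, ∑ b, ∑ c, xAB a b * xAC a c * xBC b c * μC c)
          + (∑ a, (∑ b, ∑ e, xAB a b * xAD a e * xBD b e) * μA a)
          + (∑ a, ∑ b, (∑ e, xAB a b * xAD a e * xBD b e) * μB b)
          + (∑ a, ∑ b, ∑ e, xAB a b * xAD a e * xBD b e * μD e)
          + (∑ a, (∑ c, ∑ e, xAC a c * xAD a e * xCD c e) * μA a)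
          + (∑ a, ∑ c, (∑ e, xAC a c * xAD a e * xCD c e) * μC c)
          + (∑ a, ∑ c, ∑ e, xAC a c * xAD a e * xCD c e * μD e)
          + (∑ b, (∑ c, ∑ e, xBC b c * xBD b e * xCD c e) * μB b)
          + (∑ b, ∑ c, (∑ e, xBC b c * xBD b e * xCD c e) * μC c)
          + (∑ b, ∑ c, ∑ e, xBC b c * xBD b e * xCD c e * μD e))
        - 2 * ((tB + tC + tD) * (∑ a, μA a * μA a) + (tA + tC + tD) * (∑ b, μB b * μB b)
          + (tA + tB + tD) * (∑ c, μC c * μC c) + (tA + tB + tC) * (∑ e, μD e * μD e))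
        - 3 * m * s * (tA + tB + tC + tD) - 24 * m ^ 2 - 36 * m * s ^ 2 :=
  UniformMarginWindow.marginWindow_of_momentM_of_phiLaw tA tB tC tD m s μA μB μC μD xAB xAC xAD xBC xBD xCD
    zAB zAC zAD zBC zBD zCD hTABC hTABD hTACD hTBCD
    (UniformMarginPhiLaw.phi_law_of_fourSet m s μA μB μC μD xAB xAC xAD xBC xBD xCD hmA hmB hmC rAB cAB rAC cAC
      rAD cAD rBC cBC rBD cBD rCD cCD h4)
    (UniformMarginMomentIdentity.marginMomentM tA tB tC tD m μA μB μC μD xAB xAC xAD xBC xBD xCD hA hB hC hD hmA hmB hmC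
      rAB cAB rAC cAC rAD cAD rBC cBC rBD cBD rCD cCD)

end UniformMarginWindowDesign
end Summit.Ventures.HSemireg
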